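import Mathlib
import Summits.Ventures.HodgeRepro.Tier4.Common.RowWeights
import Summits.Ventures.HodgeRepro.Tier4.Line4.L1ClassV3
import Summits.Ventures.HodgeRepro.Tier4.Line4.ArchDistBounds
import Summits.Ventures.HodgeRepro.Tier4.Line4.IntegerArchBound

/-!
# Tier4/Line4/ArchDistLower — the archimedean read-out of the sparse coset in the `archDist` vocabulary

Blind re-derivation cell `pub-hodge-repro`, Tier 4 «prove the step» (README §9–§10), seat t4-L1-p3 (gen 4; L4 service
prover; lead (R-24) / plan-4 S14998: the orbit size is `archDist`, L3-p2 S15022: «take `ArchDistLower.lean`»).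
Tree path `lean/Summits/Ventures/HodgeRepro/Tier4/Line4/ArchDistLower.lean`.

`archDist W x = ∑_w log (max 1 (archSizeAt W w x))` (L1ClassV3) sums `log⁺` of the `ℓ¹` size of the `4×4` entries of `x`
over the infinite places.  A LOWER bound on `archDist` therefore needs only ONE place and ONE entry:

* `norm_entry_le_archSizeAt` — one entry is at most the `ℓ¹` size;
* `log_max_one_le_archDist_of_le_archSizeAt` / `log_le_archDist_of_le_archSizeAt` — `r ≤ archSizeAt W w x` gives
  `log (max 1 r) ≤ archDist W x` (and `log r ≤ archDist W x` for `r > 0`);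
* `norm_adToC_algebraMap` — a RATIONAL entry `e : k` read at `w` has norm `w e` (the extension embedding of the
  completion is an isometry, the completion norm of `e` is `w e`);
* `apply_le_archSizeAt_of_mat_eq` — for a rational matrix `m` of `γ`, `w (m i j) ≤ archSizeAt W w γ`;
* **the read-out of the sparse coset** (`IntegerArchBound.exists_infinitePlace_natCast_le_entry`): for `γ = κ γ₀ κ'`
  with `κ, κ' ∈ K(N)`, `γ₀` rational finite-integral, `γ` rational and `γ ≠ γ₀`, some place `w` and entry `(i, j)` have
  `N − ‖γ₀ᵢⱼ‖_w ≤ archSizeAt W w γ` (`exists_infinitePlace_natCast_sub_le_archSizeAt`), hence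
  `log (max 1 (N − B)) ≤ archDist W γ` for any `B` bounding the entries of `γ₀` at every place
  (`log_max_one_le_archDist_of_levelK`), in particular for `B = ∑_w archSizeAt W w γ₀`
  (`log_max_one_le_archDist_of_levelK'`) — the shape `g N = log (max 1 (N − B))` of (S1) in form (B).

HONEST SCOPE (answer to L3-p2 S15026): the congruence lemma `entry_sub_mem_N_smul_of_mem_levelK_mul` needs
`γ = κ γ₀ κ'` with `κ, κ' ∈ K(N)` LITERALLY; it does not absorb finite torus parts `t_f ∈ T(𝔸_f)`.  What passes through
`T(𝔸) × T′(𝔸)` is a `T × T′`-INVARIANT integral polynomial of the entries (L1-p4's `N_{E/k}` of the `(0,0)` `E`-entry,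
S14958); this file reads ANY such quantity into `archDist` through `log_le_archDist_of_le_archSizeAt` once it is bounded
by a power of `archSizeAt` — the invariant itself is not defined here.  No printed input.
HC_CM is NOT proved by anyone in this repository.
-/

namespace Summit.Ventures.HodgeRepro.Tier4.Line4.L1Class

open Summit.Ventures.HodgeRepro.Tier4 Summit.Ventures.HodgeRepro.Tier4.Common NumberField Topology

noncomputable section

section ReadOut

variable {k : Type} [Field k] [NumberField k] (W : PlaneData k)

/-- One entry of `x` read at `w` is bounded by the `ℓ¹` size `archSizeAt W w x`. -/
theorem norm_entry_le_archSizeAt (w : InfinitePlace k) (x : GA W) (i j : Fin 4) :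
    ‖Common.adToC w (GA.mat W x i j)‖ ≤ archSizeAt W w x := by
  unfold archSizeAt
  calc ‖Common.adToC w (GA.mat W x i j)‖
      ≤ ∑ j' : Fin 4, ‖Common.adToC w (GA.mat W x i j')‖ :=
        Finset.single_le_sum (f := fun j' => ‖Common.adToC w (GA.mat W x i j')‖)
          (fun _ _ => norm_nonneg _) (Finset.mem_univ j)
    _ ≤ ∑ i' : Fin 4, ∑ j' : Fin 4, ‖Common.adToC w (GA.mat W x i' j')‖ :=
        Finset.single_le_sum (f := fun i' => ∑ j' : Fin 4, ‖Common.adToC w (GA.mat W x i' j')‖)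
          (fun _ _ => Finset.sum_nonneg fun _ _ => norm_nonneg _) (Finset.mem_univ i)

/-- `log⁺` of the size at ONE place is at most `archDist` (every summand of `archDist` is `≥ 0`). -/
theorem log_max_one_archSizeAt_le_archDist (w : InfinitePlace k) (x : GA W) :
    Real.log (max 1 (archSizeAt W w x)) ≤ archDist W x := by
  unfold archDist
  exact Finset.single_le_sum (f := fun w' => Real.log (max 1 (archSizeAt W w' x)))
    (fun w' _ => Real.log_nonneg (le_max_left _ _)) (Finset.mem_univ w)

/-- A lower bound `r ≤ archSizeAt W w x` at one place gives `log (max 1 r) ≤ archDist W x`. -/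
theorem log_max_one_le_archDist_of_le_archSizeAt {w : InfinitePlace k} {x : GA W} {r : ℝ}
    (h : r ≤ archSizeAt W w x) : Real.log (max 1 r) ≤ archDist W x := by
  refine le_trans ?_ (log_max_one_archSizeAt_le_archDist W w x)
  exact Real.log_le_log (lt_of_lt_of_le zero_lt_one (le_max_left _ _)) (max_le_max le_rfl h)

/-- A lower bound `0 < r ≤ archSizeAt W w x` at one place gives `log r ≤ archDist W x`. -/
theorem log_le_archDist_of_le_archSizeAt {w : InfinitePlace k} {x : GA W} {r : ℝ} (hr : 0 < r)
    (h : r ≤ archSizeAt W w x) : Real.log r ≤ archDist W x := by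
  refine le_trans ?_ (log_max_one_le_archDist_of_le_archSizeAt W h)
  exact Real.log_le_log hr (le_max_right _ _)

/-- A rational entry `e : k` read at the place `w` has norm `w e`. -/
theorem norm_adToC_algebraMap (w : InfinitePlace k) (e : k) :
    ‖Common.adToC w (algebraMap k (Ad k) e)‖ = w e := by
  rw [Common.adToC_algebraMap,
    (InfinitePlace.Completion.isometry_extensionEmbedding w).norm_map_of_map_zero (map_zero _),
    InfinitePlace.Completion.algebraMap_apply, InfinitePlace.Completion.norm_coe]
  rfl

/-- For a rational matrix `m` of `γ` (`GA.mat W γ = m.map (algebraMap k (Ad k))`), every entry satisfies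
`w (m i j) ≤ archSizeAt W w γ`. -/
theorem apply_le_archSizeAt_of_mat_eq {γ : GA W} {m : Matrix (Fin 4) (Fin 4) k}
    (hm : GA.mat W γ = m.map (algebraMap k (Ad k))) (w : InfinitePlace k) (i j : Fin 4) :
    w (m i j) ≤ archSizeAt W w γ := by
  have h := norm_entry_le_archSizeAt W w γ i j
  rw [hm, Matrix.map_apply, norm_adToC_algebraMap] at h
  exact h

/-- `GA.mat` is injective: an element of `G(𝔸)` is its matrix. -/
theorem GA.mat_injective : Function.Injective (GA.mat W) := fun _ _ h => Subtype.ext (Units.ext h)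

/-- An absolute value of a difference is at most the sum of the absolute values. -/
theorem InfinitePlace.apply_sub_le (w : InfinitePlace k) (a b : k) : w (a - b) ≤ w a + w b := by
  rw [← InfinitePlace.norm_embedding_eq, ← InfinitePlace.norm_embedding_eq,
    ← InfinitePlace.norm_embedding_eq, map_sub]
  exact norm_sub_le _ _

/-- **THE READ-OUT OF THE SPARSE COSET INTO `archSizeAt`**: for rational `γ = κ γ₀ κ'` with `κ, κ' ∈ K(N)`, `γ₀`
rational finite-integral, `N ≠ 0` and `γ ≠ γ₀`, some infinite place `w` and some entry `(i, j)` satisfy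
`N − ‖(γ₀)ᵢⱼ‖_w ≤ archSizeAt W w γ`. -/
theorem exists_infinitePlace_natCast_sub_le_archSizeAt {N : ℕ} (hN : N ≠ 0) {κ κ' γ₀ : GA W}
    (hκ : κ ∈ levelK W N) (hκ' : κ' ∈ levelK W N) (hγ₀ : γ₀ ∈ rationalPoints W)
    (hint : IsIntegralFin W γ₀) (hγ : κ * γ₀ * κ' ∈ rationalPoints W) (hne : κ * γ₀ * κ' ≠ γ₀) :
    ∃ w : InfinitePlace k, ∃ i j : Fin 4,
      (N : ℝ) - ‖Common.adToC w (GA.mat W γ₀ i j)‖ ≤ archSizeAt W w (κ * γ₀ * κ') := by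
  obtain ⟨m, m₀, hm, hm₀, hd⟩ := exists_infinitePlace_natCast_le_entry W hN hκ hκ' hγ₀ hint hγ
  have hex : ∃ i j, m i j ≠ m₀ i j := by
    by_contra hcon
    simp only [not_exists, ne_eq, not_not] at hcon
    apply hne
    apply GA.mat_injective W
    rw [hm, hm₀]
    congr 1
    ext i j
    exact hcon i j
  obtain ⟨i, j, hij⟩ := hex
  obtain ⟨w, hw⟩ := hd i j hij
  refine ⟨w, i, j, ?_⟩
  have h1 := InfinitePlace.apply_sub_le w (m i j) (m₀ i j)
  have h2 := apply_le_archSizeAt_of_mat_eq W hm w i j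
  have h3 : ‖Common.adToC w (GA.mat W γ₀ i j)‖ = w (m₀ i j) := by
    rw [hm₀, Matrix.map_apply, norm_adToC_algebraMap]
  rw [h3]
  linarith

/-- **THE READ-OUT INTO `archDist`, the (S1) shape**: with `B` bounding every entry of `γ₀` at every infinite
place, `log (max 1 (N − B)) ≤ archDist W (κ γ₀ κ')` for `κ, κ' ∈ K(N)`, `κ γ₀ κ'` rational and `≠ γ₀`. -/
theorem log_max_one_le_archDist_of_levelK {N : ℕ} (hN : N ≠ 0) {κ κ' γ₀ : GA W}
    (hκ : κ ∈ levelK W N) (hκ' : κ' ∈ levelK W N) (hγ₀ : γ₀ ∈ rationalPoints W)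
    (hint : IsIntegralFin W γ₀) (hγ : κ * γ₀ * κ' ∈ rationalPoints W) (hne : κ * γ₀ * κ' ≠ γ₀)
    {B : ℝ} (hB : ∀ (w : InfinitePlace k) (i j : Fin 4), ‖Common.adToC w (GA.mat W γ₀ i j)‖ ≤ B) :
    Real.log (max 1 ((N : ℝ) - B)) ≤ archDist W (κ * γ₀ * κ') := by
  obtain ⟨w, i, j, hw⟩ :=
    exists_infinitePlace_natCast_sub_le_archSizeAt W hN hκ hκ' hγ₀ hint hγ hne
  have h := hB w i j
  exact log_max_one_le_archDist_of_le_archSizeAt W (by linarith)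

/-- The same with the explicit bound `B = ∑_w archSizeAt W w γ₀` (no binder to display). -/
theorem log_max_one_le_archDist_of_levelK' {N : ℕ} (hN : N ≠ 0) {κ κ' γ₀ : GA W}
    (hκ : κ ∈ levelK W N) (hκ' : κ' ∈ levelK W N) (hγ₀ : γ₀ ∈ rationalPoints W)
    (hint : IsIntegralFin W γ₀) (hγ : κ * γ₀ * κ' ∈ rationalPoints W) (hne : κ * γ₀ * κ' ≠ γ₀) :
    Real.log (max 1 ((N : ℝ) - ∑ w : InfinitePlace k, archSizeAt W w γ₀)) ≤
      archDist W (κ * γ₀ * κ') := by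
  refine log_max_one_le_archDist_of_levelK W hN hκ hκ' hγ₀ hint hγ hne fun w i j => ?_
  refine (norm_entry_le_archSizeAt W w γ₀ i j).trans ?_
  exact Finset.single_le_sum (fun w' _ => archSizeAt_nonneg W w' γ₀) (Finset.mem_univ w)

end ReadOut

end

end Summit.Ventures.HodgeRepro.Tier4.Line4.L1Class
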